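import Mathlib.RingTheory.MvPolynomial.WeightedHomogeneous
import Mathlib.RingTheory.FiniteType
import Mathlib.RingTheory.RegularLocalRing.Polynomial
import Mathlib.Algebra.Order.Antidiag.Finsupp
import Mathlib.RingTheory.KrullDimension.Polynomial
import Mathlib.RingTheory.KrullDimension.Field
import Literature.AlgebraicGeometry.Resolution.AffineBlowupAlgebra
import Literature.AlgebraicGeometry.Resolution.AffineBlowup
import Literature.AlgebraicGeometry.Resolution.AffineDomainDimension
import HarnessLib

/-!
# Cone programme: the Veronese subring `k[xᵈ : |d| = r] ⊆ k[x₁,…,xₙ]` has Krull dimension `n`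

Support file for crux stmt-ResolutionOfSingularities-15317 (`FrobeniusLadder.FRationalResolution`), line `redirect`,
lead c5, CONE PROGRAMME (rung 4′ in all dimensions on the Veronese cones `V(n,r) = Spec k[χᵈ : |d| = r]`).

For `1 ≤ r` the `r`-th Veronese subring `VR[n,r] = k[xᵈ : |d| = r]` of the polynomial ring
`P = k[x₁,…,xₙ]` has Krull dimension `n`:

* `veronese_X_pow_mem` — `xⱼʳ = x^(r eⱼ)` is a degree-`r` monomial, hence lies in `VR[n,r]`;
* `veronese_isIntegral_X` — so every variable `xⱼ` is integral over `VR[n,r]` (root of `Tʳ - xⱼʳ`);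
* `veronese_isIntegral` — hence `P`, generated over `k ⊆ VR[n,r]` by the `xⱼ`, is integral over
  `VR[n,r]` (induction on polynomials: constants, sums, products with a variable);
* `stub_veronese_ringKrullDim` — Krull dimension is invariant under injective integral extensions
  (`Literature.AlgebraicGeometry.Resolution.ringKrullDim_eq_of_isIntegral`, Matsumura Thm. 9.4) and
  `dim k[x₁,…,xₙ] = n` (`MvPolynomial.ringKrullDim_of_isNoetherianRing`), so `dim VR[n,r] = n`.

All folklore (Matsumura, *Commutative Ring Theory*, Thm. 9.4 / Thm. 5.6); no published fact is used
beyond the tree lemma. [folklore]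
-/

-- single-problem summit: the doubled namespace component is forced
set_option linter.dupNamespace false

noncomputable section

namespace Summit.ResolutionOfSingularities.ResolutionOfSingularities.Theorems.FRationalResolution

open MvPolynomial
open Literature.AlgebraicGeometry.Resolution

section Cones

variable (k : Type) [Field k]

/-- The polynomial ring in `n` variables. -/
local notation3 "MP[" n "]" => MvPolynomial (Fin n) k

/-- The `r`-th Veronese subring of `k[x₁,…,xₙ]`: the `k`-subalgebra generated by the degree-`r` monomials. -/
local notation3 "VR[" n ", " r "]" =>
  Algebra.adjoin k ((fun d : Fin n →₀ ℕ => MvPolynomial.monomial d (1 : k)) ''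
    {d : Fin n →₀ ℕ | Finsupp.degree d = (r : ℕ)})

/-- The vertex ideal of the Veronese cone: spanned by the degree-`r` monomials. -/
local notation3 "VM[" n ", " r "]" =>
  Ideal.span {v : ↥VR[n, r] | ∃ d : Fin n →₀ ℕ, Finsupp.degree d = (r : ℕ) ∧
    (v : MvPolynomial (Fin n) k) = MvPolynomial.monomial d 1}

/-- The pure powers `xⱼʳ = x^(r eⱼ)` are degree-`r` monomials, hence lie in the Veronese subring
`VR[n,r]`. [folklore] -/
theorem veronese_X_pow_mem (n r : ℕ) (j : Fin n) : (X j : MP[n]) ^ r ∈ VR[n, r] := by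
  refine Algebra.subset_adjoin ⟨Finsupp.single j r, ?_, ?_⟩
  · show Finsupp.degree (Finsupp.single j r) = r
    exact Finsupp.degree_single j r
  · show MvPolynomial.monomial (Finsupp.single j r) (1 : k) = X j ^ r
    exact (X_pow_eq_monomial).symm

/-- For `1 ≤ r` every variable `xⱼ` is integral over the Veronese subring `VR[n,r]`: it is a root of
the monic polynomial `Tʳ - xⱼʳ` with `xⱼʳ ∈ VR[n,r]`. [folklore] -/
theorem veronese_isIntegral_X (n r : ℕ) (hr : 1 ≤ r) (j : Fin n) :
    IsIntegral ↥VR[n, r] (X j : MP[n]) := by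
  refine IsIntegral.of_pow (Nat.lt_of_lt_of_le Nat.zero_lt_one hr) ?_
  have h : (X j : MP[n]) ^ r =
      algebraMap ↥VR[n, r] MP[n] ⟨(X j : MP[n]) ^ r, veronese_X_pow_mem k n r j⟩ := rfl
  rw [h]
  exact isIntegral_algebraMap

/-- For `1 ≤ r` the polynomial ring `k[x₁,…,xₙ]` is integral over its Veronese subring `VR[n,r]`:
it is generated over `k ⊆ VR[n,r]` by the variables, which are integral (`veronese_isIntegral_X`),
and integral elements form a subring. [folklore] -/
theorem veronese_isIntegral (n r : ℕ) (hr : 1 ≤ r) : Algebra.IsIntegral ↥VR[n, r] MP[n] := by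
  refine ⟨fun f => ?_⟩
  induction f using MvPolynomial.induction_on with
  | C a =>
    have h : (C a : MP[n]) = algebraMap ↥VR[n, r] MP[n] (algebraMap k ↥VR[n, r] a) := rfl
    rw [h]
    exact isIntegral_algebraMap
  | add p q hp hq => exact hp.add hq
  | mul_X p j hp => exact hp.mul (veronese_isIntegral_X k n r hr j)

/-- STUB (the Veronese cone is `n`-dimensional): for `1 ≤ r` the `r`-th Veronese subring
`VR[n,r] = k[xᵈ : |d| = r] ⊆ k[x₁,…,xₙ]`, the coordinate ring of the cone over the `r`-th Veronese
embedding of `ℙⁿ⁻¹`, has Krull dimension `n`. The inclusion `VR[n,r] ⊆ k[x₁,…,xₙ]` is an injective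
integral extension (`veronese_isIntegral`: each `xⱼ` is a root of `Tʳ - xⱼʳ`, `xⱼʳ ∈ VR[n,r]`), and
Krull dimension is invariant under injective integral extensions (`ringKrullDim_eq_of_isIntegral`,
going up + incomparability), so `dim VR[n,r] = dim k[x₁,…,xₙ] = n`.
[folklore; Matsumura1987 Thm. 9.4 / 5.6] -/
theorem stub_veronese_ringKrullDim (n r : ℕ) (hr : 1 ≤ r) : ringKrullDim ↥VR[n, r] = n := by
  haveI : Algebra.IsIntegral ↥VR[n, r] MP[n] := veronese_isIntegral k n r hr
  have hinj : Function.Injective (algebraMap ↥VR[n, r] MP[n]) := Subtype.val_injective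
  rw [← ringKrullDim_eq_of_isIntegral hinj, MvPolynomial.ringKrullDim_of_isNoetherianRing,
    ringKrullDim_eq_zero_of_field, Nat.card_eq_fintype_card, Fintype.card_fin, zero_add]

end Cones

end Summit.ResolutionOfSingularities.ResolutionOfSingularities.Theorems.FRationalResolution

end
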